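import Summits.FinalStateConjecture.FinalStateConjecture.Theorems.PhaseMixingCaptureNearExtremalKappaCaptureFaceRedShiftAbsorb
import Literature.Geometry.Lorentzian.KerrRedShiftHorizon

/-!
# S2 · `stub_faceRedShift`: the Dafermos–Rodnianski red-shift is non-degenerate on the face collar

Stub S2 of the line `unit-temperature-front-face` for the crux `NearExtremalKappaCapture`
(route `PhaseMixingCapture`, item stmt-FinalStateConjecture-10606), with `N₁ = 1`:
for `M > 0` and every sub-extremal spin `|a| < M`, the red-shift vector field
`N = (1 + h₁(r − r₊))K + (1 + f₁(r − r₊))k` (`Kerr.redShiftVector`) with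
`h₁ = f₁ = 64/√(M² − a²)` (so `|h₁| + |f₁| ≤ (256/M²) κ⁻¹`) has bulk term
`K^N ≥ (κ/32)(λ² + v² + |q̸|²)` at every point of the collar `|r − r₊| ≤ 10⁻⁴ (r₊ − r₋)`,
`κ = Kerr.surfaceGravity M a`: Dafermos–Rodnianski arXiv:0811.0354, Thm. 7.1, with the compactness
step replaced by explicit constants that are powers of `κ`, uniformly on `|a| < M`.

The horizon case is `Kerr.redShift_horizon_coercive_kappa` (`KerrRedShiftHorizon.lean`). Off the
horizon the exact formula `Kerr.multiplierBulk_redShiftVector` is rewritten through three point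
identities proved here —
* `raisedDotRadius_eq_comp` / `raisedDotRadius_eq_hawking`: `g⁻¹(p, dr) = 2Hv + (aΠ + (r² + a²)ℓ⃗·p⃗)/Σ`
  (the component expansion of `Kerr.raisedDotRadius_of_radius_eq_rPlus` without `Δ = 0`),
* `frameOut_eq_raised`: `u = 2g⁻¹(p, dr) + (Δ/Σ + |∇̸r|²)v − 2q̸·∇̸r`,
* `axialComp_eq` / `axialComp_mul`: `Π(1 − cω₊) = q̸·φ̸ − cλ`, `c = a(x₁² + x₂²)/(r² + a²)`,
  `c² ≤ a²`, `(q̸·φ̸)² ≤ (r² + a²)|q̸|²` —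
and the resulting real inequality is `collar_algebra` of `…FaceRedShiftAbsorb.lean`.
-/

noncomputable section

-- the doubled `FinalStateConjecture.FinalStateConjecture` path component trips dupNamespace
set_option linter.dupNamespace false

namespace Summit.FinalStateConjecture.FinalStateConjecture.Theorems.NearExtremalKappaCapture.UnitTemperatureFrontFace

open Literature.Geometry.Lorentzian
open Literature.Geometry.Lorentzian.Kerr
open Set Filter
open scoped Topology Manifold ENNReal ContDiff

variable {M a : ℝ} {x : E4}

/-! ### Point identities off the horizon -/

/-- **`g⁻¹(p, dr)` at a general point**, in components: for `r > 0`,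
`g⁻¹(p, dr) = 2H v + (a Π + (r² + a²) ℓ⃗·p⃗)/Σ`, `Π = x₁p₂ − x₂p₁`, `v = p(k)` — the component
expansion of `Kerr.raisedDotRadius_of_radius_eq_rPlus` without the horizon relation
`M = (r² + a²)/(2r)`. -/
theorem raisedDotRadius_eq_comp (M a : ℝ) (hx : 0 < radius a x) (p : Fin 4 → ℝ) :
    raisedDotRadius M a x p = 2 * scalarH M a x * frameIn a x p +
      (a * (x 1 * p 2 - x 2 * p 1) + (radius a x ^ 2 + a ^ 2) * spatialDotNull a x p) /
        blSigma a (E4.spatial x) := by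
  have hS := blSigma_spatial_pos hx
  have hQ : radius a x ^ 2 + a ^ 2 ≠ 0 := by positivity
  have hr : radius a x ≠ 0 := hx.ne'
  rw [raisedDotRadius]
  simp only [sum_inverseMetric_mul_eq]
  have hsplit : ∑ μ, ((if μ = 0 then -1 else 1) * p μ +
      2 * scalarH M a x * frameIn a x p * nullVector a x μ) * dRadius a x μ =
      ∑ μ, (if μ = 0 then -1 else 1) * p μ * dRadius a x μ +
        2 * scalarH M a x * frameIn a x p * ∑ μ, nullVector a x μ * dRadius a x μ := by
    rw [Finset.mul_sum, ← Finset.sum_add_distrib]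
    exact Finset.sum_congr rfl fun μ _ ↦ by ring
  rw [hsplit, sum_nullVector_mul_dRadius hx, mul_one]
  simp only [spatialDotNull_eq, Fin.sum_univ_four, Fin.isValue, dRadius_apply,
    fderiv_radius_basisVector_zero a hx, fderiv_radius_basisVector_one hx,
    fderiv_radius_basisVector_two hx, fderiv_radius_basisVector_three hx, nullCovectorFun_apply_one,
    nullCovectorFun_apply_two, nullCovectorFun_apply_three]
  simp only [show (1 : Fin 4) ≠ 0 from by decide, show (2 : Fin 4) ≠ 0 from by decide,
    show (3 : Fin 4) ≠ 0 from by decide, if_true, if_false]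
  field_simp
  ring

/-- `g⁻¹(p, dr)` in terms of the horizon-adapted components: with `λ = p(K) = p₀ + ω₊Π`,
`v = p(k) = p₀ − ℓ⃗·p⃗`, `g⁻¹(p, dr) = 2H v + (a Π + (r² + a²)(λ − ω₊Π − v))/Σ`. -/
theorem raisedDotRadius_eq_hawking (M a : ℝ) (hx : 0 < radius a x) (p : Fin 4 → ℝ) :
    raisedDotRadius M a x p = 2 * scalarH M a x * frameIn a x p +
      (a * (x 1 * p 2 - x 2 * p 1) + (radius a x ^ 2 + a ^ 2) *
        (hawkingComp M a x p - horizonAngularVelocity M a * (x 1 * p 2 - x 2 * p 1) -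
          frameIn a x p)) / blSigma a (E4.spatial x) := by
  rw [raisedDotRadius_eq_comp M a hx p, hawkingComp_eq, frameIn_eq]
  ring

/-- **`u = p(m)` at a general point**: `u = 2 g⁻¹(p, dr) + (Δ/Σ + |∇̸r|²) v − 2 q̸·∇̸r`,
`q = p + v dr` (from `g⁻¹(p, dr) = ½u − ½(1 − 2H)v + p̸·∇̸r` and `1 − 2H = Δ/Σ − |∇̸r|²`). -/
theorem frameOut_eq_raised (M a : ℝ) (hx : 0 < radius a x) (p : Fin 4 → ℝ) :
    frameOut M a x p = 2 * raisedDotRadius M a x p +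
      ((radius a x ^ 2 - 2 * M * radius a x + a ^ 2) / blSigma a (E4.spatial x) +
        frameAngSq a x (dRadius a x)) * frameIn a x p -
      2 * frameAng a x (p + frameIn a x p • dRadius a x) (dRadius a x) := by
  have h1 := raisedDotRadius_eq_frame M a hx p
  have h2 := raisedDotRadius_dRadius M hx
  have h3 := raisedDotRadius_eq_frame M a hx (dRadius a x)
  rw [frameOut_dRadius M hx, frameIn_dRadius hx, frameAng_self] at h3
  rw [frameAng_add_smul_left, frameAng_self]
  linear_combination (-2) * h1 + frameIn a x p * h2 - frameIn a x p * h3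

/-- The spatial coordinates satisfy `x₁² + x₂² = (r² + a²)(r² − x₃²)/r²` (the defining quartic of
`r`), hence `x₁² + x₂² ≤ r² + a²`. -/
theorem sq_add_sq_le (hx : 0 < radius a x) : x 1 ^ 2 + x 2 ^ 2 ≤ radius a x ^ 2 + a ^ 2 := by
  have hq := radius_quartic a x
  rw [E4.spatialNorm_sq] at hq
  have h1 : (x 1 ^ 2 + x 2 ^ 2) * radius a x ^ 2 =
      (radius a x ^ 2 + a ^ 2) * (radius a x ^ 2 - x 3 ^ 2) := by
    linear_combination (-1) * hq
  have h2 : (x 1 ^ 2 + x 2 ^ 2) * radius a x ^ 2 ≤ (radius a x ^ 2 + a ^ 2) * radius a x ^ 2 := by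
    rw [h1]
    nlinarith [sq_nonneg (x 3), sq_nonneg a, sq_nonneg (radius a x)]
  exact le_of_mul_le_mul_right h2 (by positivity)

/-- The coefficient `c = a (x₁² + x₂²)/(r² + a²)` (`= a sin²θ`) has `c² ≤ a²`. -/
theorem sq_axialCoeff_le (hx : 0 < radius a x) :
    (a * (x 1 ^ 2 + x 2 ^ 2) / (radius a x ^ 2 + a ^ 2)) ^ 2 ≤ a ^ 2 := by
  have hQ : 0 < radius a x ^ 2 + a ^ 2 := by positivity
  have hρ0 : 0 ≤ (x 1 ^ 2 + x 2 ^ 2) / (radius a x ^ 2 + a ^ 2) := by positivity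
  have hρ1 : (x 1 ^ 2 + x 2 ^ 2) / (radius a x ^ 2 + a ^ 2) ≤ 1 := by
    rw [div_le_one hQ]; exact sq_add_sq_le hx
  rw [mul_div_assoc, mul_pow]
  exact mul_le_of_le_one_right (sq_nonneg a) (pow_le_one₀ hρ0 hρ1)

/-- **The axial component `Π = x₁p₂ − x₂p₁` in the horizon frame**: with `q = p + v dr` and the
axial covector `φ = (0, −x₂, x₁, 0)` (the components of `Kerr.axialVector x`),
`Π = q̸·φ̸ − c p₀`, `c = a(x₁² + x₂²)/(r² + a²)` (since `Φ(r) = 0`, `ℓ⃗·q⃗ = p₀`,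
`ℓ⃗·φ⃗ = −c`). -/
theorem axialComp_eq (hx : 0 < radius a x) (p : Fin 4 → ℝ) :
    x 1 * p 2 - x 2 * p 1 =
      frameAng a x (p + frameIn a x p • dRadius a x) (fun μ ↦ axialVector x μ) -
        a * (x 1 ^ 2 + x 2 ^ 2) / (radius a x ^ 2 + a ^ 2) * p 0 := by
  have hS := blSigma_spatial_pos hx
  have hQ : radius a x ^ 2 + a ^ 2 ≠ 0 := by positivity
  have hr : radius a x ≠ 0 := hx.ne'
  have hsdn_q : spatialDotNull a x (p + frameIn a x p • dRadius a x) = p 0 := by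
    have hlin : spatialDotNull a x (p + frameIn a x p • dRadius a x) =
        spatialDotNull a x p + frameIn a x p * spatialDotNull a x (dRadius a x) := by
      simp only [spatialDotNull, Pi.add_apply, Pi.smul_apply, smul_eq_mul, Fin.sum_univ_three]
      ring
    rw [hlin, spatialDotNull_dRadius hx, frameIn_eq]
    ring
  have hsum_q : ∑ i : Fin 3, (p + frameIn a x p • dRadius a x) i.succ * axialVector x i.succ =
      x 1 * p 2 - x 2 * p 1 := by
    simp only [Fin.sum_univ_three, Pi.add_apply, Pi.smul_apply, smul_eq_mul, Fin.succ_zero_eq_one,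
      Fin.succ_one_eq_two, fin_succ_two_eq_three, axialVector_apply_one, axialVector_apply_two,
      axialVector_apply_three, dRadius_apply, fderiv_radius_basisVector_one hx,
      fderiv_radius_basisVector_two hx]
    field_simp
    ring
  have hsdn_φ : spatialDotNull a x (fun μ ↦ axialVector x μ) =
      -(a * (x 1 ^ 2 + x 2 ^ 2) / (radius a x ^ 2 + a ^ 2)) := by
    rw [spatialDotNull_eq]
    simp only [axialVector_apply_one, axialVector_apply_two, axialVector_apply_three,
      nullCovectorFun_apply_one, nullCovectorFun_apply_two]
    field_simp
    ring
  rw [frameAng, hsum_q, hsdn_q, hsdn_φ]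
  ring

/-- `Π (1 − c ω₊) = B − c λ` with `B = q̸·φ̸`, `λ = p(K) = p₀ + ω₊ Π`. -/
theorem axialComp_mul (M : ℝ) (hx : 0 < radius a x) (p : Fin 4 → ℝ) :
    (x 1 * p 2 - x 2 * p 1) *
        (1 - a * (x 1 ^ 2 + x 2 ^ 2) / (radius a x ^ 2 + a ^ 2) * horizonAngularVelocity M a) =
      frameAng a x (p + frameIn a x p • dRadius a x) (fun μ ↦ axialVector x μ) -
        a * (x 1 ^ 2 + x 2 ^ 2) / (radius a x ^ 2 + a ^ 2) * hawkingComp M a x p := by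
  have h1 := axialComp_eq hx p
  rw [hawkingComp_eq]
  linear_combination h1

/-- **`(q̸·φ̸)² ≤ (r² + a²) |q̸|²`**: Cauchy–Schwarz for the angular pairing and
`|φ̸|² ≤ |φ⃗|² = x₁² + x₂² ≤ r² + a²`. -/
theorem axial_frameAng_sq_le (hx : 0 < radius a x) (q : Fin 4 → ℝ) :
    frameAng a x q (fun μ ↦ axialVector x μ) ^ 2 ≤ (radius a x ^ 2 + a ^ 2) * frameAngSq a x q := by
  have hCS := frameAng_sq_le hx q (fun μ ↦ axialVector x μ)
  have hF : frameAngSq a x (fun μ ↦ axialVector x μ) ≤ radius a x ^ 2 + a ^ 2 := by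
    refine (frameAngSq_le a x _).trans ?_
    simp only [Fin.sum_univ_three, Fin.succ_zero_eq_one, Fin.succ_one_eq_two, fin_succ_two_eq_three,
      axialVector_apply_one, axialVector_apply_two, axialVector_apply_three]
    nlinarith [sq_add_sq_le (a := a) hx]
  have hQ := frameAngSq_nonneg hx q
  calc frameAng a x q (fun μ ↦ axialVector x μ) ^ 2
      ≤ frameAngSq a x q * frameAngSq a x (fun μ ↦ axialVector x μ) := hCS
    _ ≤ frameAngSq a x q * (radius a x ^ 2 + a ^ 2) := mul_le_mul_of_nonneg_left hF hQ
    _ = (radius a x ^ 2 + a ^ 2) * frameAngSq a x q := by ring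

/-! ### The stub -/

/-- **S2 · `stub_faceRedShift` — the Dafermos–Rodnianski red-shift is non-degenerate ON THE FACE,
i.e. holds on the collar of blown-up width `θ₀` with constants that are explicit powers of `κ`,
uniformly on `|a| < M`.** For `M > 0` there are `N₁`, `A`, `θ₀ > 0`, `b > 0` (here `N₁ = 1`,
`A = 256/M²`, `θ₀ = 10⁻⁴`, `b = 1/32`) such that for every sub-extremal spin `a` there are
multiplier parameters `h₁, f₁` with `|h₁| + |f₁| ≤ A κ^{−N₁}` (`κ = Kerr.surfaceGravity M a`; here
`h₁ = f₁ = 64/√(M² − a²)`) for which the bulk term `K^N = T_{μν}[w] ∇^μ N^ν`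
(`KerrSchild.multiplierBulk` for `g⁻¹ = Kerr.inverseMetric M a`) of the red-shift vector field
`N = (1 + h₁(r − r₊))K + (1 + f₁(r − r₊))k` (`Kerr.redShiftVector M a h₁ f₁`) satisfies, at every
point of the collar `|r − r₊| ≤ θ₀ (r₊ − r₋)` and for every `w` differentiable at the point,
`K^N ≥ b κ^{N₁} (λ² + v² + |q̸|²)`, `λ = dw(K)`, `v = dw(k)`, `q̸ = (dw + v dr)` angular part.
Dafermos–Rodnianski arXiv:0811.0354, Thm. 7.1 ("`K^N ≥ b J^N·N` near `𝓗⁺`, `b` from `κ > 0`")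
with the compactness step replaced by the explicit collar algebra `collar_algebra`. -/
theorem stub_faceRedShift :
    (∀ M : ℝ, 0 < M → ∃ (N₁ : ℕ) (A θ₀ b : ℝ), 0 < θ₀ ∧ 0 < b ∧
      ∀ a : ℝ, Kerr.IsSubextremal M a → ∃ h₁ f₁ : ℝ,
        |h₁| + |f₁| ≤ A * (Kerr.surfaceGravity M a)⁻¹ ^ N₁ ∧
        ∀ x : E4, |Kerr.radius a x - Kerr.rPlus M a| ≤ θ₀ * (Kerr.rPlus M a - Kerr.rMinus M a) →
          ∀ w : E4 → ℝ, DifferentiableAt ℝ w x →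
            b * Kerr.surfaceGravity M a ^ N₁ *
                (Kerr.hawkingComp M a x (fun μ ↦ fderiv ℝ w x (E4.basisVector μ)) ^ 2 +
                  Kerr.frameIn a x (fun μ ↦ fderiv ℝ w x (E4.basisVector μ)) ^ 2 +
                  Kerr.frameAngSq a x ((fun μ ↦ fderiv ℝ w x (E4.basisVector μ)) +
                    Kerr.frameIn a x (fun μ ↦ fderiv ℝ w x (E4.basisVector μ)) • Kerr.dRadius a x)) ≤
              KerrSchild.multiplierBulk (Kerr.inverseMetric M a) (Kerr.redShiftVector M a h₁ f₁) w x) := by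
  intro M hM
  refine ⟨1, 256 / M ^ 2, 1 / 10000, 1 / 32, by norm_num, by norm_num, ?_⟩
  intro a hMa
  have hMa' : |a| ≤ M := le_of_lt hMa
  have ha2 : a ^ 2 < M ^ 2 := sq_lt_sq' (abs_lt.1 hMa).1 (abs_lt.1 hMa).2
  obtain ⟨s, hs_def⟩ : ∃ s : ℝ, s = √(M ^ 2 - a ^ 2) := ⟨_, rfl⟩
  have hs : 0 < s := by rw [hs_def]; exact Real.sqrt_pos.2 (sub_pos.2 ha2)
  have hsM : s ≤ M := by
    rw [hs_def]
    calc √(M ^ 2 - a ^ 2) ≤ √(M ^ 2) := Real.sqrt_le_sqrt (by nlinarith [sq_nonneg a])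
      _ = M := Real.sqrt_sq hM.le
  have has : a ^ 2 + s ^ 2 = M ^ 2 := by
    rw [hs_def, Real.sq_sqrt (sub_nonneg.2 ha2.le)]; ring
  have hrp : rPlus M a = M + s := by rw [hs_def]; rfl
  have hrpm : rPlus M a - rMinus M a = 2 * s := by rw [rPlus_sub_rMinus, hs_def]
  have hκ : surfaceGravity M a = s / (2 * M * rPlus M a) := by
    rw [surfaceGravity_eq_div_two_mul_rPlus hMa', hs_def]
  have hMs : 0 < M + s := by linarith
  refine ⟨64 / s, 64 / s, ?_, ?_⟩
  · -- the size of the multiplier: `128/s ≤ (256/M²) κ⁻¹ = 512 (M + s)/(M s)`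
    rw [pow_one, hκ, hrp, inv_div, abs_of_pos (div_pos (by norm_num) hs)]
    rw [show 256 / M ^ 2 * (2 * M * (M + s) / s) = 512 * (M + s) / (M * s) by field_simp; ring,
      ← add_div, div_le_div_iff₀ hs (by positivity)]
    nlinarith [mul_pos hM hs]
  · intro x hxc w _
    rw [hrpm] at hxc
    have hx : 0 < radius a x := by
      have h := (abs_le.1 hxc).1
      rw [hrp] at h
      linarith
    set p : Fin 4 → ℝ := fun μ ↦ fderiv ℝ w x (E4.basisVector μ) with hp_def
    rw [pow_one, multiplierBulk_redShiftVector M a _ _ hx w, ← hp_def,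
      raisedDotRadius_mul_frameIn_add M hx p]
    exact collar_algebra hM hs hsM has hrp hxc (sq_le_blSigma_spatial hx) (frameAngSq_dRadius hx)
      (frameAngSq_nonneg hx _) (scalarH_eq_div_blSigma M a hx) (fderiv_scalarH_nullVector M hx)
      (frameAngSq_nonneg hx _) (frameAng_sq_le hx _ _) (axial_frameAng_sq_le hx _)
      (sq_axialCoeff_le hx) (rfl : horizonAngularVelocity M a = a / (2 * M * rPlus M a))
      (axialComp_mul M hx p) (raisedDotRadius_eq_hawking M a hx p) (frameOut_eq_raised M a hx p)
      rfl hκ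

end Summit.FinalStateConjecture.FinalStateConjecture.Theorems.NearExtremalKappaCapture.UnitTemperatureFrontFace

end
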